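import Summits.BirchSwinnertonDyer.BirchSwinnertonDyer.Theorems.EisensteinPrimesMazurMCOnCellBTwistbackTwistLineCharacters
import Summits.BirchSwinnertonDyer.Rank1Residual.X2.IsogenyQuotientLine
import Summits.BirchSwinnertonDyer.Rank1Residual.X2.IsogenyLineType
import HarnessLib

/-!
# Crux 3 `MazurMCOnCellB` (stmt-BirchSwinnertonDyer-19033), line `twistback` v4 — the TWIST-CHARACTER
# DICTIONARY, part 2 (package): the line datum WITH EXPLICIT PRIMITIVE CHARACTERS `(φχ̄, ψχ̄)` of the
# quadratic twist of an X2b curve, in both Greenberg–Vatsal shapes, in the binder shape of the KL-flat door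

Width seat bsd-line-x2-p1-w3 (gen 8), cell `bsd-eis` (run/shared/lean/pub/bsd-eis/), 2026-08-28. HONEST FRAMING:
Galois-module / Dirichlet-character algebra; THEOREMS ONLY (no `def`, no named fact introduced, no `sorry`); §4 takes
the two Tate-uniformisation facts `hT`, `hT'` BY NAME (Silverman *ATAEC* V.5.3 / V.5.4, as everywhere in the X2
kernel); `--supports` stmt-BirchSwinnertonDyer-19033; closes no stub by itself; no summit statement, no Mazur main
conjecture and no BSD is proved for any curve; 0 cells / labels / tiers move.

WHAT. Data throughout: `p` odd; `D < 0` with `p ∤ D` (the partner's `d_K`); a quadratic `ℤ`-valued character `χ`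
modulo `N` with the radical relation `τ√D = χ(χ_N(τ))·√D` (e.g. the tree's Gauss-sum characters) whose reduction
`χ̄ = χ mod p` is PRIMITIVE modulo `N`; a rational line `Φ₀ ≤ W[p]` with PRIMITIVE characters `φ` (mod `m`) on `Φ₀`
and `ψ` (mod `d`) on `W[p]/Φ₀` in the door's binder shape; `gcd(m, N) = gcd(d, N) = 1` (on the twistback road: every
prime of `m·d` is `p` or a bad prime of `W`, and those split in `K` — Heegner); a model `Wd` of `W^{(D)}`.

* §1 `exists_signEquiv_signs` — the sign-equivariant `e : Wd[p] ≃ W[p]` (`exists_signEquiv_of_twist`) with the signs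
  of `e` and `e⁻¹`, inertia above `p` fixing `√D` (`p ∤ 4D`) and complex conjugation negating it (`D < 0`);
  `not_dvd_level_of_radical` — `p ∤ N` (`χ̄∘χ_N` is unramified at `p`, `χ̄` primitive).
* §2 `exists_twistLine_ramifiedEven_characters` — FIRST X2b SHAPE: `Φ₀` RAMIFIED-ODD (`p ∣ m`, `p ∤ d`) ⟹ `Wd[p]`
  has a rational line RAMIFIED at `p` and EVEN with the PRIMITIVE characters `φχ̄` (mod `mN`, `p ∣ mN`) and `ψχ̄`
  (mod `dN`, `p ∤ dN`) — nine conjuncts of the door's `hKL` (p645525 §3) at `V′ = Wd`, characters EXPLICIT.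
* §3 `exists_twistLine_unramifiedOdd_characters` — SECOND X2b SHAPE: `Φ₀` UNRAMIFIED-EVEN (`p ∤ m`, `p ∣ d`) ⟹ a
  rational line of `Wd[p]` UNRAMIFIED at `p` and ODD with primitive characters `(φχ̄, ψχ̄)`.
* §4 `exists_isogenous_ramifiedEvenLine_characters` — GV's reduction `E′ = E/Φ` WITH CHARACTERS at `p ‖ N`: an
  unramified-odd rational line `Ψ₀ ≤ Wd[p]` with characters `(φ′, ψ′)` yields a globally minimal `V′` `ℚ`-isogenous to
  `Wd` with a RAMIFIED-EVEN rational line of characters `(ψ′, φ′)` (the image of `Wd[p]` under the quotient isogeny;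
  types by `X2/IsogenyLineType`, characters by part 1 §3); `exists_isogenous_twistLine_ramifiedEven_characters` —
  §3 + §4: in the second shape, the door's `∃ V′` prefix with the primitive characters `(ψχ̄ mod dN, φχ̄ mod mN)`,
  `p ∣ dN`, `p ∤ mN`.

WHAT THIS GIVES THE LEAD (road (c) into stub 6, verdict g10 §2/§4): in both X2b shapes the door's line characters of
the partner are `φ_E·χ_K` and `ψ_E·χ_K` EXPLICITLY, so its remaining conditions are about `E` and `K` only: the
indicators `[(φχ̄)(ℓ) = ℓ̄]` are read by part 1's `changeLevel_mul_changeLevel_apply_natCast` (`= [φ(ℓ) = ℓ̄]` at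
`ℓ` split in `K`, false at `ℓ ∣ d_K`), and the KL-flat units are those of the odd quadratic character among
`φχ̄ω⁻¹`, `ψχ̄` of conductor `d·|d_K|` resp. `(m/p)·|d_K|` (w3 g7's class-number form). NOT here: the local
`δ`-terms of the twist, the `S₀`-clauses, the supply of `χ` for a given `d_K`, the existence of admissible `K`.

References: [GreenbergVatsal2000] Thm. (1.3) and the remark after it, §2 p. 28; [SilvermanAEC2009] X.5 Cor. 5.4;
[SilvermanATAEC1994] Thm. V.5.3, Cor. V.5.4; [CastellaEtAl2021] proof of Thm. 5.3.1 (the twist `E ↦ E^K` swaps the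
Greenberg–Vatsal types); [Washington1997] Ch. 3.
-/

set_option autoImplicit false

-- `Summit.BirchSwinnertonDyer.BirchSwinnertonDyer.…`: the summit and its single sub-problem share a name.
set_option linter.dupNamespace false

noncomputable section

open scoped Classical

open WeierstrassCurve NumberField IsDedekindDomain Field DirichletCharacter
  Literature.NumberTheory.EllipticCurves Literature.NumberTheory.GaloisRepresentations
  Literature.NumberTheory.EllipticCurves.Rank1Residual
  Summit.BirchSwinnertonDyer.Rank1Residual.X2.PrimeOrderCharacters
  Summit.BirchSwinnertonDyer.Rank1Residual.X2
  Summit.BirchSwinnertonDyer.BirchSwinnertonDyer.Theorems.EisensteinPrimesMazurMCOnCellBTwistbackTwistLineCharacters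

namespace Summit.BirchSwinnertonDyer.BirchSwinnertonDyer.Theorems.EisensteinPrimesMazurMCOnCellBTwistbackTwistLineCharactersPackage

variable {W Wd : WeierstrassCurve ℚ} {p : ℕ} [hp : Fact p.Prime]

/-! ## §1. The sign-equivariant identification of an odd twist unramified at `p`, with its signs -/

/-- **The twisting identification `e : Wd[p] ≃ W[p]` of an ODD twist UNRAMIFIED at `p`, with all its signs**
(`p` odd, `D < 0`, `p ∤ D`, `C • Wd = W^{(D)}`): `e(σT) = σe(T)` if `σ√D = √D` and `= −σe(T)` otherwise, the same
for `e⁻¹`; every inertia element above `p` fixes `√D` (`p ∤ 4D`); no complex conjugation fixes `√D` (`D < 0`).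
[cite: SilvermanAEC2009, X.5 Cor. 5.4] [cite: GreenbergVatsal2000, Thm. (1.3) and the remark after it] -/
theorem exists_signEquiv_signs (hp2 : p ≠ 2) {D : ℤ} (hD : D < 0) (hpD : ¬ (p : ℤ) ∣ D)
    (C : VariableChange ℚ) (hC : C • Wd = W.quadraticTwist ((D : ℤ) : ℚ)) :
    ∃ e : geomTorsion Wd (p : ℤ) ≃+ geomTorsion W (p : ℤ),
      (∀ σ : absoluteGaloisGroup ℚ, σ • geomSqrt ((D : ℤ) : ℚ) = geomSqrt ((D : ℤ) : ℚ) →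
        ∀ T, e (σ • T) = σ • e T) ∧
      (∀ σ : absoluteGaloisGroup ℚ, ¬ σ • geomSqrt ((D : ℤ) : ℚ) = geomSqrt ((D : ℤ) : ℚ) →
        ∀ T, e (σ • T) = -(σ • e T)) ∧
      (∀ σ : absoluteGaloisGroup ℚ, σ • geomSqrt ((D : ℤ) : ℚ) = geomSqrt ((D : ℤ) : ℚ) →
        ∀ S, e.symm (σ • S) = σ • e.symm S) ∧
      (∀ σ : absoluteGaloisGroup ℚ, ¬ σ • geomSqrt ((D : ℤ) : ℚ) = geomSqrt ((D : ℤ) : ℚ) →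
        ∀ S, e.symm (σ • S) = -(σ • e.symm S)) ∧
      (∀ (v : HeightOneSpectrum (𝓞 ℚ)), (p : 𝓞 ℚ) ∈ v.asIdeal → ∀ 𝔓 ∈ v.primesAbove,
        ∀ σ ∈ 𝔓.inertia (absoluteGaloisGroup ℚ), σ • geomSqrt ((D : ℤ) : ℚ) = geomSqrt ((D : ℤ) : ℚ)) ∧
      (∀ c : absoluteGaloisGroup ℚ, IsComplexConjugation (Rat.castHom ℝ) c →
        ¬ c • geomSqrt ((D : ℤ) : ℚ) = geomSqrt ((D : ℤ) : ℚ)) := by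
  have hD0 : ((D : ℤ) : ℚ) ≠ 0 := by exact_mod_cast hD.ne
  have hDneg : ((D : ℤ) : ℚ) < 0 := by exact_mod_cast hD
  obtain ⟨e, hpos, hneg⟩ := exists_signEquiv_of_twist (W := W) (Wd := Wd) (p := p) hD0 C hC
  refine ⟨e, hpos, hneg, fun σ hσ S ↦ ?_, fun σ hσ S ↦ ?_, fun v hv 𝔓 h𝔓 σ hσ ↦ ?_, fun c hc h ↦ ?_⟩
  · apply e.injective
    rw [e.apply_symm_apply, hpos σ hσ, e.apply_symm_apply]
  · apply e.injective
    rw [e.apply_symm_apply, map_neg, hneg σ hσ, e.apply_symm_apply, neg_neg]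
  · exact smul_geomSqrt_eq_of_mem_inertia (p := p) (not_dvd_four_mul hp2 hpD) hv h𝔓 hσ
  · have h' := smul_geomSqrt_eq_neg_of_isComplexConjugation hDneg hc
    rw [h] at h'
    exact geomSqrt_ne_neg hD0 h'

/-- **`p ∤ N` for the quadratic character of `ℚ(√D)`, `p ∤ 4D`**: the character `χ̄∘χ_N` is trivial on an
inertia group above `p` (it fixes `√D`), and `χ̄` is PRIMITIVE mod `N` (tree
`not_dvd_level_of_isPrimitive_of_forall_mem_inertia`). [cite: Washington1997, Ch. 3 (conductor and ramification)] -/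
theorem not_dvd_level_of_radical {D : ℤ} (hD0 : ((D : ℤ) : ℚ) ≠ 0) (hpD : ¬ (p : ℤ) ∣ 4 * D)
    {N : ℕ} [NeZero N] (χ : MulChar (ZMod N) ℤ) (hχ2 : χ.IsQuadratic)
    (hχ : ∀ τ : absoluteGaloisGroup ℚ,
      τ • geomSqrt ((D : ℤ) : ℚ) =
        ((χ (modNCyclotomicCharacter ℚ N τ : ZMod N) : ℤ) : AlgebraicClosure ℚ) * geomSqrt ((D : ℤ) : ℚ))
    (hχp : DirichletCharacter.IsPrimitive
      (χ.ringHomComp (Int.castRingHom (ZMod p)) : DirichletCharacter (ZMod p) N)) :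
    ¬ p ∣ N := by
  obtain ⟨v, hv⟩ :=
    Literature.NumberTheory.NumberFields.RingOfIntegers.exists_heightOneSpectrum_natCast_mem ℚ hp.out
  refine not_dvd_level_of_isPrimitive_of_forall_mem_inertia hχp hp.out hv
    (adicCompletionPrime_mem_primesAbove ℚ v) (fun τ hτ ↦ ?_)
  rcases apply_eq_one_and_smul_eq_or hD0 χ hχ2 hχ τ with ⟨h1, -⟩ | ⟨-, hnfix⟩
  · rw [ringHomComp_apply_eq_intCast, h1, Int.cast_one]
  · exact absurd (smul_geomSqrt_eq_of_mem_inertia (p := p) hpD hv (adicCompletionPrime_mem_primesAbove ℚ v) hτ)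
      hnfix

/-! ## §2. First X2b shape: line RAMIFIED-ODD ⟹ twist line RAMIFIED-EVEN, characters `(φχ̄, ψχ̄)` -/

/-- **The twist-character dictionary, first X2b shape (line RAMIFIED-ODD ⟹ twist line RAMIFIED-EVEN).** Data: `p`
odd; `D < 0` with `p ∤ D`; a quadratic `ℤ`-valued character `χ` mod `N` cutting out `ℚ(√D)`
(`τ√D = χ(χ_N(τ))·√D`) whose reduction `χ̄ = χ mod p` is PRIMITIVE mod `N`; a rational line `Φ₀ ≤ W[p]` RAMIFIED at
`p` and ODD with PRIMITIVE characters `φ` (mod `m`, `p ∣ m`) on `Φ₀` and `ψ` (mod `d`, `p ∤ d`) on `W[p]/Φ₀`,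
`gcd(m, N) = gcd(d, N) = 1`; a model `Wd` of the twist (`C • Wd = W^{(D)}`). Conclusion: `Wd[p]` carries a
rational line `Ψ₀` which is RAMIFIED at `p` and EVEN, on which `Γ_ℚ` acts through the PRIMITIVE character `φχ̄`
(mod `mN`, `p ∣ mN`), with PRIMITIVE quotient character `ψχ̄` (mod `dN`, `p ∤ dN`) — the line datum of the KL-flat
door (`…TwistbackKLFlatPartner` §1/§3) at `V′ = Wd`, all characters EXPLICIT (`Ψ₀ = e⁻¹(Φ₀)`).
[cite: SilvermanAEC2009, X.5 Cor. 5.4] [cite: GreenbergVatsal2000, Thm. (1.3) and the remark after it, §2 p. 28]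
[cite: CastellaEtAl2021, proof of Thm. 5.3.1 (the twist E ↦ E^K swaps the GV types)] -/
theorem exists_twistLine_ramifiedEven_characters (hp2 : p ≠ 2) {D : ℤ} (hD : D < 0) (hpD : ¬ (p : ℤ) ∣ D)
    {N : ℕ} [NeZero N] (χ : MulChar (ZMod N) ℤ) (hχ2 : χ.IsQuadratic)
    (hχ : ∀ τ : absoluteGaloisGroup ℚ,
      τ • geomSqrt ((D : ℤ) : ℚ) =
        ((χ (modNCyclotomicCharacter ℚ N τ : ZMod N) : ℤ) : AlgebraicClosure ℚ) * geomSqrt ((D : ℤ) : ℚ))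
    (hχp : DirichletCharacter.IsPrimitive
      (χ.ringHomComp (Int.castRingHom (ZMod p)) : DirichletCharacter (ZMod p) N))
    {Φ₀ : AddSubgroup (geomTorsion W (p : ℤ))} (hΦ : IsRationalLine W p Φ₀)
    (hram : ¬ LineUnramifiedAt W p Φ₀) (hodd : LineOdd W p Φ₀)
    {m : ℕ} [NeZero m] (φ : DirichletCharacter (ZMod p) m) {d : ℕ} [NeZero d]
    (ψ : DirichletCharacter (ZMod p) d) (hφ : φ.IsPrimitive) (hψ : ψ.IsPrimitive) (hpm : p ∣ m)
    (hpd : ¬ p ∣ d) (hmN : m.Coprime N) (hdN : d.Coprime N)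
    (hφ0 : ∀ (σ : absoluteGaloisGroup ℚ), ∀ P ∈ Φ₀,
      σ • P = (φ ((modNCyclotomicCharacter ℚ m σ : (ZMod m)ˣ) : ZMod m)).val • P)
    (hψ0 : ∀ (σ : absoluteGaloisGroup ℚ) (P : geomTorsion W (p : ℤ)),
      σ • P - (ψ ((modNCyclotomicCharacter ℚ d σ : (ZMod d)ˣ) : ZMod d)).val • P ∈ Φ₀)
    (C : VariableChange ℚ) (hC : C • Wd = W.quadraticTwist ((D : ℤ) : ℚ)) :
    ∃ Ψ₀ : AddSubgroup (geomTorsion Wd (p : ℤ)),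
      IsRationalLine Wd p Ψ₀ ∧ ¬ LineUnramifiedAt Wd p Ψ₀ ∧ LineEven Wd p Ψ₀ ∧
      (changeLevel (dvd_mul_right m N) φ *
          changeLevel (dvd_mul_left N m) (χ.ringHomComp (Int.castRingHom (ZMod p))) :
        DirichletCharacter (ZMod p) (m * N)).IsPrimitive ∧
      (changeLevel (dvd_mul_right d N) ψ *
          changeLevel (dvd_mul_left N d) (χ.ringHomComp (Int.castRingHom (ZMod p))) :
        DirichletCharacter (ZMod p) (d * N)).IsPrimitive ∧
      p ∣ m * N ∧ ¬ p ∣ d * N ∧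
      (∀ (σ : absoluteGaloisGroup ℚ), ∀ Q ∈ Ψ₀,
        σ • Q = ((changeLevel (dvd_mul_right m N) φ *
            changeLevel (dvd_mul_left N m) (χ.ringHomComp (Int.castRingHom (ZMod p))) :
          DirichletCharacter (ZMod p) (m * N))
          ((modNCyclotomicCharacter ℚ (m * N) σ : (ZMod (m * N))ˣ) : ZMod (m * N))).val • Q) ∧
      (∀ (σ : absoluteGaloisGroup ℚ) (Q : geomTorsion Wd (p : ℤ)),
        σ • Q - ((changeLevel (dvd_mul_right d N) ψ *
            changeLevel (dvd_mul_left N d) (χ.ringHomComp (Int.castRingHom (ZMod p))) :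
          DirichletCharacter (ZMod p) (d * N))
          ((modNCyclotomicCharacter ℚ (d * N) σ : (ZMod (d * N))ˣ) : ZMod (d * N))).val • Q ∈ Ψ₀) := by
  have hD0 : ((D : ℤ) : ℚ) ≠ 0 := by exact_mod_cast hD.ne
  obtain ⟨e, hpos, hneg, hpos', hneg', hI, hcc⟩ :=
    exists_signEquiv_signs (W := W) (Wd := Wd) (p := p) hp2 hD hpD C hC
  have hpN : ¬ p ∣ N := not_dvd_level_of_radical hD0 (not_dvd_four_mul hp2 hpD) χ hχ2 hχ hχp
  refine ⟨Φ₀.map e.symm.toAddMonoidHom, ?_, ?_, ?_, ?_, ?_, ?_, ?_, ?_, ?_⟩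
  · exact isRationalLine_map_signEquiv e.symm _ hpos' hneg' hΦ
  · rw [← lineUnramifiedAt_map_signEquiv_iff e _ hpos hI, map_comap_signEquiv]
    exact hram
  · rw [← lineOdd_map_signEquiv_iff_of_neg e _ hneg hcc, map_comap_signEquiv]
    exact hodd
  · exact isPrimitive_changeLevel_mul_changeLevel hφ hχp hmN
  · exact isPrimitive_changeLevel_mul_changeLevel hψ hχp hdN
  · exact Dvd.dvd.mul_right hpm N
  · exact fun h ↦ (hp.out.dvd_mul.mp h).elim hpd hpN
  · exact fun σ Q hQ ↦ smul_eq_twistChar_of_mem_map_symm e hpos hneg hD0 χ hχ2 hχ φ hφ0 σ Q hQ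
  · exact fun σ Q ↦ smul_sub_twistChar_mem_map_symm e hpos hneg hD0 χ hχ2 hχ Φ₀ ψ hψ0 σ Q

/-! ## §3. Second X2b shape: line UNRAMIFIED-EVEN ⟹ twist line UNRAMIFIED-ODD, characters `(φχ̄, ψχ̄)` -/

/-- **The twist-character dictionary, second X2b shape (line UNRAMIFIED-EVEN ⟹ twist line UNRAMIFIED-ODD).** Same
data as `exists_twistLine_ramifiedEven_characters` but with `Φ₀` UNRAMIFIED at `p` and EVEN (so `p ∤ m`, `p ∣ d`).
Conclusion: `Wd[p]` carries a rational line `Ψ₀` UNRAMIFIED at `p` and ODD with the PRIMITIVE characters `φχ̄`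
(mod `mN`, `p ∤ mN`) on `Ψ₀` and `ψχ̄` (mod `dN`, `p ∣ dN`) on `Wd[p]/Ψ₀` — Greenberg–Vatsal's second case; §4
moves it to the RAMIFIED-EVEN line `g(Wd[p])` of `V′ = Wd/Ψ₀` with characters `(ψχ̄, φχ̄)`.
[cite: SilvermanAEC2009, X.5 Cor. 5.4] [cite: GreenbergVatsal2000, Thm. (1.3) and §2 p. 28] -/
theorem exists_twistLine_unramifiedOdd_characters (hp2 : p ≠ 2) {D : ℤ} (hD : D < 0) (hpD : ¬ (p : ℤ) ∣ D)
    {N : ℕ} [NeZero N] (χ : MulChar (ZMod N) ℤ) (hχ2 : χ.IsQuadratic)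
    (hχ : ∀ τ : absoluteGaloisGroup ℚ,
      τ • geomSqrt ((D : ℤ) : ℚ) =
        ((χ (modNCyclotomicCharacter ℚ N τ : ZMod N) : ℤ) : AlgebraicClosure ℚ) * geomSqrt ((D : ℤ) : ℚ))
    (hχp : DirichletCharacter.IsPrimitive
      (χ.ringHomComp (Int.castRingHom (ZMod p)) : DirichletCharacter (ZMod p) N))
    {Φ₀ : AddSubgroup (geomTorsion W (p : ℤ))} (hΦ : IsRationalLine W p Φ₀)
    (hunr : LineUnramifiedAt W p Φ₀) (heven : LineEven W p Φ₀)
    {m : ℕ} [NeZero m] (φ : DirichletCharacter (ZMod p) m) {d : ℕ} [NeZero d]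
    (ψ : DirichletCharacter (ZMod p) d) (hφ : φ.IsPrimitive) (hψ : ψ.IsPrimitive) (hpm : ¬ p ∣ m)
    (hpd : p ∣ d) (hmN : m.Coprime N) (hdN : d.Coprime N)
    (hφ0 : ∀ (σ : absoluteGaloisGroup ℚ), ∀ P ∈ Φ₀,
      σ • P = (φ ((modNCyclotomicCharacter ℚ m σ : (ZMod m)ˣ) : ZMod m)).val • P)
    (hψ0 : ∀ (σ : absoluteGaloisGroup ℚ) (P : geomTorsion W (p : ℤ)),
      σ • P - (ψ ((modNCyclotomicCharacter ℚ d σ : (ZMod d)ˣ) : ZMod d)).val • P ∈ Φ₀)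
    (C : VariableChange ℚ) (hC : C • Wd = W.quadraticTwist ((D : ℤ) : ℚ)) :
    ∃ Ψ₀ : AddSubgroup (geomTorsion Wd (p : ℤ)),
      IsRationalLine Wd p Ψ₀ ∧ LineUnramifiedAt Wd p Ψ₀ ∧ LineOdd Wd p Ψ₀ ∧
      (changeLevel (dvd_mul_right m N) φ *
          changeLevel (dvd_mul_left N m) (χ.ringHomComp (Int.castRingHom (ZMod p))) :
        DirichletCharacter (ZMod p) (m * N)).IsPrimitive ∧
      (changeLevel (dvd_mul_right d N) ψ *
          changeLevel (dvd_mul_left N d) (χ.ringHomComp (Int.castRingHom (ZMod p))) :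
        DirichletCharacter (ZMod p) (d * N)).IsPrimitive ∧
      ¬ p ∣ m * N ∧ p ∣ d * N ∧
      (∀ (σ : absoluteGaloisGroup ℚ), ∀ Q ∈ Ψ₀,
        σ • Q = ((changeLevel (dvd_mul_right m N) φ *
            changeLevel (dvd_mul_left N m) (χ.ringHomComp (Int.castRingHom (ZMod p))) :
          DirichletCharacter (ZMod p) (m * N))
          ((modNCyclotomicCharacter ℚ (m * N) σ : (ZMod (m * N))ˣ) : ZMod (m * N))).val • Q) ∧
      (∀ (σ : absoluteGaloisGroup ℚ) (Q : geomTorsion Wd (p : ℤ)),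
        σ • Q - ((changeLevel (dvd_mul_right d N) ψ *
            changeLevel (dvd_mul_left N d) (χ.ringHomComp (Int.castRingHom (ZMod p))) :
          DirichletCharacter (ZMod p) (d * N))
          ((modNCyclotomicCharacter ℚ (d * N) σ : (ZMod (d * N))ˣ) : ZMod (d * N))).val • Q ∈ Ψ₀) := by
  have hD0 : ((D : ℤ) : ℚ) ≠ 0 := by exact_mod_cast hD.ne
  obtain ⟨e, hpos, hneg, hpos', hneg', hI, hcc⟩ :=
    exists_signEquiv_signs (W := W) (Wd := Wd) (p := p) hp2 hD hpD C hC
  have hpN : ¬ p ∣ N := not_dvd_level_of_radical hD0 (not_dvd_four_mul hp2 hpD) χ hχ2 hχ hχp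
  refine ⟨Φ₀.map e.symm.toAddMonoidHom, ?_, ?_, ?_, ?_, ?_, ?_, ?_, ?_, ?_⟩
  · exact isRationalLine_map_signEquiv e.symm _ hpos' hneg' hΦ
  · rw [← lineUnramifiedAt_map_signEquiv_iff e _ hpos hI, map_comap_signEquiv]
    exact hunr
  · rw [← lineEven_map_signEquiv_iff_of_neg e _ hneg hcc, map_comap_signEquiv]
    exact heven
  · exact isPrimitive_changeLevel_mul_changeLevel hφ hχp hmN
  · exact isPrimitive_changeLevel_mul_changeLevel hψ hχp hdN
  · exact fun h ↦ (hp.out.dvd_mul.mp h).elim hpm hpN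
  · exact Dvd.dvd.mul_right hpd N
  · exact fun σ Q hQ ↦ smul_eq_twistChar_of_mem_map_symm e hpos hneg hD0 χ hχ2 hχ φ hφ0 σ Q hQ
  · exact fun σ Q ↦ smul_sub_twistChar_mem_map_symm e hpos hneg hD0 χ hχ2 hχ Φ₀ ψ hψ0 σ Q

/-! ## §4. Second shape, continued: along the quotient isogeny `Wd → V′ = Wd/Ψ₀` (GV's `E′ = E/Φ` with characters) -/

/-- **An unramified-odd rational line with characters `(φ′, ψ′)` yields, on the `p`-isogenous globally minimal
curve, a RAMIFIED-EVEN rational line with characters `(ψ′, φ′)`** — at an odd MULTIPLICATIVE prime, granted the Tate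
uniformisation facts `hT`, `hT'` (as `X2/IsogenyLineType`). For `Wd/ℚ` globally minimal, multiplicative at `p ≠ 2`,
`Ψ₀ ≤ Wd[p]` a rational line UNRAMIFIED at `p` and ODD on which `φ′` (mod `m`) acts, with `ψ′` (mod `d`) acting on
`Wd[p]/Ψ₀`: there are a globally minimal elliptic `V′` `ℚ`-isogenous to `Wd` (the quotient `Wd/Ψ₀`,
`X2/IsogenyQuotientLine.exists_isogeny_ker_eq_line`) and a rational line `Φ′ ≤ V′[p]` RAMIFIED at `p` and EVEN
(`X2/IsogenyLineType.isRationalLine_range_and_ramified_even_of_ker`) on which `ψ′` acts, with quotient character `φ′`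
(part 1 §3, Weil pairing). [cite: GreenbergVatsal2000, §2 p. 28 (E′ = E/Φ, φψ = ω)]
[cite: SilvermanATAEC1994, Thm. V.5.3 and Cor. V.5.4] [cite: SilvermanAEC2009, Prop. III.4.12] -/
theorem exists_isogenous_ramifiedEvenLine_characters
    (hT : Silverman1994_thmV53_tateUniformisation.{0})
    (hT' : Silverman1994_thmV53_corV54_tateUniformisation.{0})
    (hp2 : p ≠ 2) [Wd.IsElliptic] [Wd.IsGloballyMinimal] (hmult : Wd.HasMultiplicativeReductionAtPrime p)
    {Ψ₀ : AddSubgroup (geomTorsion Wd (p : ℤ))} (hΨ : IsRationalLine Wd p Ψ₀)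
    (hunr : LineUnramifiedAt Wd p Ψ₀) (hodd : LineOdd Wd p Ψ₀)
    {m : ℕ} [NeZero m] (φ : DirichletCharacter (ZMod p) m)
    (hφ0 : ∀ (σ : absoluteGaloisGroup ℚ), ∀ P ∈ Ψ₀,
      σ • P = (φ ((modNCyclotomicCharacter ℚ m σ : (ZMod m)ˣ) : ZMod m)).val • P)
    {d : ℕ} [NeZero d] (ψ : DirichletCharacter (ZMod p) d)
    (hψ0 : ∀ (σ : absoluteGaloisGroup ℚ) (P : geomTorsion Wd (p : ℤ)),
      σ • P - (ψ ((modNCyclotomicCharacter ℚ d σ : (ZMod d)ˣ) : ZMod d)).val • P ∈ Ψ₀) :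
    ∃ (V' : WeierstrassCurve ℚ) (_ : V'.IsElliptic) (_ : V'.IsGloballyMinimal), IsIsogenous Wd V' ∧
      ∃ Φ' : AddSubgroup (geomTorsion V' (p : ℤ)),
        IsRationalLine V' p Φ' ∧ ¬ LineUnramifiedAt V' p Φ' ∧ LineEven V' p Φ' ∧
        (∀ (σ : absoluteGaloisGroup ℚ), ∀ Q ∈ Φ',
          σ • Q = (ψ ((modNCyclotomicCharacter ℚ d σ : (ZMod d)ˣ) : ZMod d)).val • Q) ∧
        (∀ (σ : absoluteGaloisGroup ℚ) (Q : geomTorsion V' (p : ℤ)),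
          σ • Q - (φ ((modNCyclotomicCharacter ℚ m σ : (ZMod m)ˣ) : ZMod m)).val • Q ∈ Φ') := by
  obtain ⟨V', hV', hV'min, f, hker, -⟩ := IsogenyQuotientLine.exists_isogeny_ker_eq_line hΨ
  obtain ⟨g, hgval, hg⟩ := IsogenyLineType.exists_restrict_torsion (p := p) f
  -- `ker g = Ψ₀`
  have hK : g.ker = Ψ₀ := by
    ext P
    rw [AddMonoidHom.mem_ker]
    constructor
    · intro hP
      have h1 : (P : geomPoints Wd) ∈ f.toAddMonoidHom.ker := by
        rw [AddMonoidHom.mem_ker, Isogeny.coe_toAddMonoidHom, ← hgval, hP]; rfl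
      rw [hker] at h1
      obtain ⟨Q, hQ, hQP⟩ := h1
      have : Q = P := Subtype.ext hQP
      exact this ▸ hQ
    · intro hP
      have h1 : (P : geomPoints Wd) ∈ f.toAddMonoidHom.ker := by
        rw [hker]; exact ⟨P, hP, rfl⟩
      rw [AddMonoidHom.mem_ker, Isogeny.coe_toAddMonoidHom, ← hgval] at h1
      exact Subtype.ext h1
  have hKcard : Nat.card g.ker = p := by rw [hK]; exact hΨ.1
  obtain ⟨hline, hram, heven⟩ := IsogenyLineType.isRationalLine_range_and_ramified_even_of_ker g hg hp2
    (Rank1Residual.natCard_geomTorsion Wd p)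
    (IsogenyLineType.exists_tateLine_adicCompletionPrime Wd p hT hT' hp2 hmult)
    (exists_fixed_and_antifixed_of_isComplexConjugation Wd hp2) hKcard (hK ▸ hunr) (hK ▸ hodd)
  exact ⟨V', hV', hV'min, ⟨f⟩, g.range, hline, hram, heven,
    fun σ Q hQ ↦ smul_eq_of_mem_range_of_ker_eq g hg hK ψ hψ0 σ Q hQ,
    fun σ Q ↦ smul_sub_mem_range_of_ker_eq g hg hΨ hK φ hφ0 ψ hψ0 σ Q⟩

/-- **The twist-character dictionary, second X2b shape, DOOR FORM.** In the setting of
`exists_twistLine_unramifiedOdd_characters` (line of `W` UNRAMIFIED-EVEN with primitive `(φ, ψ)`, `p ∤ m`, `p ∣ d`,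
odd twist by `D < 0`, `p ∤ D`, quadratic `χ` mod `N` with `χ̄` primitive, `gcd(m,N) = gcd(d,N) = 1`), for a model
`Wd` of `W^{(D)}` which is globally minimal and MULTIPLICATIVE at `p` (on the road: `p` splits in `K`), granted the
Tate facts `hT`, `hT'`: there is a globally minimal `V′` `ℚ`-isogenous to `Wd` with a rational line RAMIFIED at `p`
and EVEN whose characters are the PRIMITIVE `ψχ̄` (mod `dN`, `p ∣ dN`) on the line and `φχ̄` (mod `mN`, `p ∤ mN`)
on the quotient — the `∃ V′` prefix of the door's `hKL` (p645525 §3) with its line / primitivity / divisibility /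
character conjuncts, characters EXPLICIT. [cite: GreenbergVatsal2000, Thm. (1.3), §2 p. 28]
[cite: SilvermanAEC2009, X.5 Cor. 5.4] [cite: SilvermanATAEC1994, Thm. V.5.3 and Cor. V.5.4] -/
theorem exists_isogenous_twistLine_ramifiedEven_characters
    (hT : Silverman1994_thmV53_tateUniformisation.{0})
    (hT' : Silverman1994_thmV53_corV54_tateUniformisation.{0})
    (hp2 : p ≠ 2) {D : ℤ} (hD : D < 0) (hpD : ¬ (p : ℤ) ∣ D)
    {N : ℕ} [NeZero N] (χ : MulChar (ZMod N) ℤ) (hχ2 : χ.IsQuadratic)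
    (hχ : ∀ τ : absoluteGaloisGroup ℚ,
      τ • geomSqrt ((D : ℤ) : ℚ) =
        ((χ (modNCyclotomicCharacter ℚ N τ : ZMod N) : ℤ) : AlgebraicClosure ℚ) * geomSqrt ((D : ℤ) : ℚ))
    (hχp : DirichletCharacter.IsPrimitive
      (χ.ringHomComp (Int.castRingHom (ZMod p)) : DirichletCharacter (ZMod p) N))
    {Φ₀ : AddSubgroup (geomTorsion W (p : ℤ))} (hΦ : IsRationalLine W p Φ₀)
    (hunr : LineUnramifiedAt W p Φ₀) (heven : LineEven W p Φ₀)
    {m : ℕ} [NeZero m] (φ : DirichletCharacter (ZMod p) m) {d : ℕ} [NeZero d]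
    (ψ : DirichletCharacter (ZMod p) d) (hφ : φ.IsPrimitive) (hψ : ψ.IsPrimitive) (hpm : ¬ p ∣ m)
    (hpd : p ∣ d) (hmN : m.Coprime N) (hdN : d.Coprime N)
    (hφ0 : ∀ (σ : absoluteGaloisGroup ℚ), ∀ P ∈ Φ₀,
      σ • P = (φ ((modNCyclotomicCharacter ℚ m σ : (ZMod m)ˣ) : ZMod m)).val • P)
    (hψ0 : ∀ (σ : absoluteGaloisGroup ℚ) (P : geomTorsion W (p : ℤ)),
      σ • P - (ψ ((modNCyclotomicCharacter ℚ d σ : (ZMod d)ˣ) : ZMod d)).val • P ∈ Φ₀)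
    [Wd.IsElliptic] [Wd.IsGloballyMinimal] (hmult : Wd.HasMultiplicativeReductionAtPrime p)
    (C : VariableChange ℚ) (hC : C • Wd = W.quadraticTwist ((D : ℤ) : ℚ)) :
    ∃ (V' : WeierstrassCurve ℚ) (_ : V'.IsElliptic) (_ : V'.IsGloballyMinimal), IsIsogenous Wd V' ∧
      ∃ Φ' : AddSubgroup (geomTorsion V' (p : ℤ)),
        IsRationalLine V' p Φ' ∧ ¬ LineUnramifiedAt V' p Φ' ∧ LineEven V' p Φ' ∧
        (changeLevel (dvd_mul_right d N) ψ *
            changeLevel (dvd_mul_left N d) (χ.ringHomComp (Int.castRingHom (ZMod p))) :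
          DirichletCharacter (ZMod p) (d * N)).IsPrimitive ∧
        (changeLevel (dvd_mul_right m N) φ *
            changeLevel (dvd_mul_left N m) (χ.ringHomComp (Int.castRingHom (ZMod p))) :
          DirichletCharacter (ZMod p) (m * N)).IsPrimitive ∧
        p ∣ d * N ∧ ¬ p ∣ m * N ∧
        (∀ (σ : absoluteGaloisGroup ℚ), ∀ Q ∈ Φ',
          σ • Q = ((changeLevel (dvd_mul_right d N) ψ *
              changeLevel (dvd_mul_left N d) (χ.ringHomComp (Int.castRingHom (ZMod p))) :
            DirichletCharacter (ZMod p) (d * N))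
            ((modNCyclotomicCharacter ℚ (d * N) σ : (ZMod (d * N))ˣ) : ZMod (d * N))).val • Q) ∧
        (∀ (σ : absoluteGaloisGroup ℚ) (Q : geomTorsion V' (p : ℤ)),
          σ • Q - ((changeLevel (dvd_mul_right m N) φ *
              changeLevel (dvd_mul_left N m) (χ.ringHomComp (Int.castRingHom (ZMod p))) :
            DirichletCharacter (ZMod p) (m * N))
            ((modNCyclotomicCharacter ℚ (m * N) σ : (ZMod (m * N))ˣ) : ZMod (m * N))).val • Q ∈ Φ') := by
  obtain ⟨Ψ₀, hΨ, hΨunr, hΨodd, hprimφ, hprimψ, hpmN, hpdN, hφ0', hψ0'⟩ :=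
    exists_twistLine_unramifiedOdd_characters (W := W) (Wd := Wd) hp2 hD hpD χ hχ2 hχ hχp hΦ hunr heven φ ψ hφ hψ
      hpm hpd hmN hdN hφ0 hψ0 C hC
  obtain ⟨V', hV', hV'min, hiso, Φ', hline, hram, hev, hψ', hφ'⟩ :=
    exists_isogenous_ramifiedEvenLine_characters (Wd := Wd) hT hT' hp2 hmult hΨ hΨunr hΨodd _ hφ0' _ hψ0'
  exact ⟨V', hV', hV'min, hiso, Φ', hline, hram, hev, hprimψ, hprimφ, hpdN, hpmN, hψ', hφ'⟩

end Summit.BirchSwinnertonDyer.BirchSwinnertonDyer.Theorems.EisensteinPrimesMazurMCOnCellBTwistbackTwistLineCharactersPackage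

end
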